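import Literature.Geometry.Lorentzian.FutureNullCompleteness
import Literature.Geometry.Lorentzian.EventHorizon
import HarnessLib

/-!
# Normalised null rays from the data lie to the causal future of the data

Elementary causal bookkeeping for Christodoulou's normalised future null rays
(`LorentzianMetric.IsNormalisedNullRayFrom`, `NullInfinity.lean`) on a Hausdorff manifold without
boundary with a smooth time-oriented Lorentzian metric: the future-directed null initial velocity
propagates along the ray (`IsGeodesicOn.isNull_and_isFutureDirected_velocity`,
`FutureNullCompleteness.lean`; O'Neill 1983, Ch. 3, p. 69 and Ch. 5, Lemma 5.26), so a normalised ray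
is a future causal curve on its whole affine domain, and its points of parameter `t ≥ 0` lie in the
causal future `J⁺(ι p) ⊆ J⁺(ι X)` of its starting point. Consequently the complete-ray region
(`completeNullRayRegion`, `EventHorizon.lean`) lies in `J⁺(ι X)`.

These facts are used by the final-state statements, whose ray clauses quantify over the points
`γ t`, `t ≥ 0`, of normalised rays (`Summit.FinalStateConjecture.RaysStayInClosure`) and whose settled
regions live in `J⁺(ι X)`.

Everything is proved; no definitions and no named facts are introduced.

## References

* B. O'Neill, *Semi-Riemannian geometry with applications to relativity*, Academic Press 1983,
  Ch. 3, p. 69; Ch. 5, Lemma 5.26; Ch. 14, p. 402 (causal curves and `J⁺`).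
* D. Christodoulou, CQG 16 (1999) A23, pp. A26–A27 (normalised null rays).
-/

noncomputable section

open Bundle Set Filter
open scoped Manifold ContDiff Topology

namespace Literature.Geometry.Lorentzian

namespace LorentzianMetric

variable {E : Type*} [NormedAddCommGroup E] [NormedSpace ℝ E] {H : Type*} [TopologicalSpace H]
  {I : ModelWithCorners ℝ E H} {M : Type*} [TopologicalSpace M] [ChartedSpace H M]
  [IsManifold I ∞ M] {X : Type*}
  {g : LorentzianMetric I ∞ M} {τ : TimeOrientation g} {ι : X → M}
  [FiniteDimensional ℝ E] [CompleteSpace E] [g.HasLeviCivita] {N : NormalField I ι}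
  [T2Space M] [BoundarylessManifold I M]

omit [T2Space M] [BoundarylessManifold I M] in
/-- The Levi-Civita connection of a smooth metric is `C¹` (instance form of
`isLocallyContMDiff_leviCivita_holds`, Gallot–Hulin–Lafontaine 2004, Prop. 2.54).
[cite: ONeillSemiRiemannian1983, Ch. 3, Thm. 3.11] -/
theorem contMDiffCovariantDerivative_leviCivita_one (g : LorentzianMetric I ∞ M) [g.HasLeviCivita] :
    CovariantDerivative.ContMDiffCovariantDerivative g.leviCivita 1 :=
  ⟨g.toPseudoRiemannianMetric.isLocallyContMDiff_leviCivita_holds 1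
    (by rw [show ((1 : ℕ∞) : ℕ∞ω) + 1 = 2 by norm_num]; exact WithTop.coe_le_coe.2 le_top)
    univ isOpen_univ⟩

/-- **The velocity of a normalised future null ray is null and future-directed at every parameter of
its affine domain** (propagation along the geodesic, O'Neill 1983, Ch. 3, p. 69 and Ch. 5,
Lemma 5.26). [cite: ONeillSemiRiemannian1983, Ch. 5, Lemma 5.26 (p. 141)] -/
theorem IsNormalisedNullRayFrom.isNull_and_isFutureDirected_velocity_of_mem {p : X} {γ : ℝ → M}
    {dom : Set ℝ} (h : g.IsNormalisedNullRayFrom τ ι N p γ dom) {t : ℝ} (ht : t ∈ dom) :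
    g.IsNull (velocity I γ t) ∧ τ.IsFutureDirected (velocity I γ t) := by
  haveI := contMDiffCovariantDerivative_leviCivita_one g
  haveI : Fact ((1 : ℕ∞ω) ≤ ∞) := ⟨WithTop.coe_le_coe.2 le_top⟩
  obtain ⟨hmax, h0, -, hnull, hfd, -⟩ := h
  exact IsGeodesicOn.isNull_and_isFutureDirected_velocity g τ hmax.1 hmax.2.1 hmax.isGeodesicOn h0
    hnull hfd ht

/-- **A normalised future null ray is a future causal curve on its affine domain.**
[cite: ONeillSemiRiemannian1983, Ch. 14, p. 402] -/
theorem IsNormalisedNullRayFrom.isFutureCausalCurveOn {p : X} {γ : ℝ → M} {dom : Set ℝ}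
    (h : g.IsNormalisedNullRayFrom τ ι N p γ dom) : g.IsFutureCausalCurveOn τ γ dom :=
  fun _ ht ↦ ⟨IsGeodesicOn.mdifferentiableAt_holds h.isMaximalGeodesicOn.isGeodesicOn ht,
    (h.isNull_and_isFutureDirected_velocity_of_mem ht).2⟩

/-- **Points of parameter `t ≥ 0` of a normalised ray lie in `J⁺(ι p)`**: for `t > 0` along the
future causal curve `γ|[0, t]` (the domain is an interval containing `0` and `t`), for `t = 0`
trivially. [cite: ONeillSemiRiemannian1983, Ch. 14, p. 402] -/
theorem IsNormalisedNullRayFrom.mem_causalFuture_singleton {p : X} {γ : ℝ → M} {dom : Set ℝ}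
    (h : g.IsNormalisedNullRayFrom τ ι N p γ dom) {t : ℝ} (ht : t ∈ dom) (ht0 : 0 ≤ t) :
    γ t ∈ g.causalFuture τ {ι p} := by
  rcases ht0.eq_or_lt with rfl | hpos
  · exact Or.inl (by rw [mem_singleton_iff, h.apply_zero])
  · refine Or.inr ⟨ι p, rfl, γ, 0, t, hpos, ?_, h.apply_zero, rfl⟩
    exact h.isFutureCausalCurveOn.mono (h.isMaximalGeodesicOn.2.1.out h.zero_mem ht)

/-- **Points of parameter `t ≥ 0` of a normalised ray from the data lie in `J⁺(ι X)`.**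
[cite: ONeillSemiRiemannian1983, Ch. 14, p. 402] -/
theorem IsNormalisedNullRayFrom.mem_causalFuture_range {p : X} {γ : ℝ → M} {dom : Set ℝ}
    (h : g.IsNormalisedNullRayFrom τ ι N p γ dom) {t : ℝ} (ht : t ∈ dom) (ht0 : 0 ≤ t) :
    γ t ∈ g.causalFuture τ (range ι) :=
  causalFuture_mono (singleton_subset_iff.2 (mem_range_self p)) (h.mem_causalFuture_singleton ht ht0)

/-- The nonnegative-parameter half of a normalised ray from the data lies in `J⁺(ι X)`.
[cite: ONeillSemiRiemannian1983, Ch. 14, p. 402] -/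
theorem IsNormalisedNullRayFrom.image_inter_Ici_subset_causalFuture {p : X} {γ : ℝ → M}
    {dom : Set ℝ} (h : g.IsNormalisedNullRayFrom τ ι N p γ dom) :
    γ '' (dom ∩ Ici 0) ⊆ g.causalFuture τ (range ι) := by
  rintro _ ⟨t, ⟨ht, ht0⟩, rfl⟩
  exact h.mem_causalFuture_range ht ht0

variable (g τ ι N) in
/-- **The complete-ray region lies to the causal future of the data**: `completeNullRayRegion ⊆ J⁺(ι X)`
(the intrinsic stand-in for "a neighbourhood of `𝓘⁺` lies in `J⁺(Σ)`"). [cite: ONeillSemiRiemannian1983, Ch. 14, p. 402] -/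
theorem completeNullRayRegion_subset_causalFuture :
    g.completeNullRayRegion τ ι N ⊆ g.causalFuture τ (range ι) := by
  intro q hq
  obtain ⟨p, δ, s, t, hδ, -, ht, ht0, rfl⟩ := mem_completeNullRayRegion_iff.1 hq
  exact hδ.mem_causalFuture_range ht ht0

end LorentzianMetric

end Literature.Geometry.Lorentzian

end
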